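import Mathlib
import Summits.Ventures.PercRepro2.Defs
import Summits.Ventures.PercRepro2.Independence
import Summits.Ventures.PercRepro2.Graph
import Summits.Ventures.PercRepro2.Induced
import Summits.Ventures.PercRepro2.DisagreementSum
import Summits.Ventures.PercRepro2.DisagreementPinned
import Summits.Ventures.PercRepro2.HullDefs
import Summits.Ventures.PercRepro2.SwitchDefs
import Summits.Ventures.PercRepro2.SwitchMap

/-!
# The total switching map in the no-exclusion form (blind cell PercRepro2, typer-1; mine-2 g8
2026-08-23T07:45:00Z note (1))

`PlusSet′ = {Q̂, o ∈ RL, b ∈ RH ∖ BH}` and `MinusSet′ = {Q̂, o ∈ RL, b ∈ BH ∖ RH}` (no condition on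
`o ∉ BL`); the switching map `flip_{R⁺}` sends `PlusSet′` into `MinusSet′` using only the `h`-side
claims (a)–(d), (f) of `SwitchMap` — claim (e) is not needed.
-/

namespace Summit.Ventures.PercRepro2

namespace Switch

open Hull

variable {V : Type*} {E : Type*} [DecidableEq E] {ends : E → Sym2 V} {G : Finset E} {ζ : Config E}
  {l h : V}

/-- The no-exclusion `+1` configurations `P′ = {Q̂, o ∈ RL, b ∈ RH ∖ BH}`. -/
def PlusSet' (ends : E → Sym2 V) (G : Finset E) (ζ : Config E) (l h o b : V) : Prop :=
  Qhat ends G ζ l h ∧ o ∈ cluster ends ζ l ∧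
    (b ∈ cluster ends ζ h ∧ b ∉ cluster ends (flipOn G ζ) h)

/-- The no-exclusion `−1` configurations `M1′ = {Q̂, o ∈ RL, b ∈ BH ∖ RH}`. -/
def MinusSet' (ends : E → Sym2 V) (G : Finset E) (ζ : Config E) (l h o b : V) : Prop :=
  Qhat ends G ζ l h ∧ o ∈ cluster ends ζ l ∧
    (b ∈ cluster ends (flipOn G ζ) h ∧ b ∉ cluster ends ζ h)

/-- **The total switching map, no-exclusion form**: `ζ ∈ P′` gives `flip_{R⁺}(ζ) ∈ M1′`. -/
theorem minusSet'_switchMap {o b : V} (hP : PlusSet' ends G ζ l h o b) :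
    MinusSet' ends G (switchMap ends G ζ l h) l h o b := by
  obtain ⟨⟨hQR, hQB⟩, hoR, ⟨hbR, hbB⟩⟩ := hP
  refine ⟨⟨?_, ?_⟩, cluster_subset_switch hoR, ⟨?_, ?_⟩⟩
  · intro hh
    have hl : l ∈ cluster ends (switchMap ends G ζ l h) h := conn_symm hh
    exact ((cluster_switch_h_subset hQR) hl).2 (mem_cluster_self _ _ _)
  · intro hh
    exact l_notMem_cluster_blue_switch hQB (conn_symm hh)
  · rw [cluster_blue_switch_eq]
    rcases RH_subset_BH_union_Rplus hQR hbR with hbB' | hbP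
    · exact absurd hbB' hbB
    · exact Or.inr hbP
  · intro hb
    exact hbB ((cluster_switch_h_subset hQR) hb).1

/-- `PlusSet ⊆ PlusSet′`. -/
lemma plusSet'_of_plusSet {o b : V} (hP : PlusSet ends G ζ l h o b) : PlusSet' ends G ζ l h o b :=
  ⟨hP.1, hP.2.1.1, hP.2.2⟩

end Switch

end Summit.Ventures.PercRepro2
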